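import Literature.NumberTheory.EllipticCurves.JetchevSkinnerWan2017.AnticyclotomicControlMultiplicative
import Literature.NumberTheory.EllipticCurves.SigmaEulerFactors
import Literature.NumberTheory.EllipticCurves.HasseWeilGoodReductionFrobenius
import Literature.NumberTheory.DiophantineGeometry.LocalReduction
import Literature.NumberTheory.GaloisRepresentations.LocalGaloisGroup
import HarnessLib

/-!
# Jetchev–Skinner–Wan 2017, Prop. 3.3.2 (surjectivity of `loc_S`) and the `Σ`-change identity of the
# proof of Thm. 6.1.6: `χ_Λ(X^{Σ₂}_ac) = χ_Λ(X^{Σ₁}_ac) · ∏_{w ∈ Σ₂∖Σ₁} (P_w(ε⁻¹Ψ⁻¹(Frob_w)))`, with the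
# `Σ`-version of the torsion clause of Thm. 3.3.1 — on the tree's `AcSelmer.XAc` and `sigmaEulerFactor`
# (CORRECTED 2026-08-27: away from the Tamagawa defect, `prop332_charIdeal_XAc_sigma_change_of_noTamagawaDefect`)

Cell `bsd-stepL` (crux `stmt-BirchSwinnertonDyer-19270`, Road FF; fact F7, Selmer side, of
SPEC-19270-RoadFF-facts-imc-p1-g8 §2: the glue's `hSig : Ch(X^∅_ac)·(P_Σ) ≤ Ch(X^Σ_ac)` and the torsion
of `X^Σ_ac`). ONE named fact (published, with proof) + PROVED corollaries in the glue's shape. No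
`sorry`. The Euler factors are the tree's `IwasawaCharacter.eulerFactor` (file `SigmaEulerFactors`,
Skinner's convention; see its module docstring and HOME/defn-ty1/EULER-FACTOR-CONVENTIONS-defn-ty1.md),
bound to the curve by the predicate `IsEulerDataAt` below (norm of `w`, reduction type of `E/K_w`,
trace `a_w`, and `κ(φ_w)` for an arithmetic Frobenius `φ_w`).

## Source, verbatim (arXiv:1512.06894 TeX, held)

* §3.3 (p0011 L50–75): "`𝒫_{𝔉_ac}(M; S') = ∏_{w∈S'} H¹(𝒦_w, M)/H¹_{𝔉_ac}(𝒦_w, M)` …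
  (restrict-eq1) `H¹(𝒦^S/𝒦, M) →^{loc_S} 𝒫_{𝔉_ac}(M; S)` … Here `𝒦^S/𝒦` is the maximal extension
  unramified at all finite places not in `S`. **Proposition 3.3.2.** The restriction maps
  (restrict-eq1) and (restrict-eq2) are surjective." (Proved there from Poitou–Tate duality under the
  running hypotheses of §3.1; for `A_f = E` these follow from (p-sst), (rank 1), (Ш 𝔭-finite),
  (𝔭-irred), §3.5 — transcribed exactly as in the tree's `thm331_anticyclotomicControl_general/_mult`.)
* §3.3, Thm. 3.3.1 (p. 11): "Let `Σ ⊂ S_p`. … The `Λ`-module `X^Σ_ac(M)` is `Λ`-torsion".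
* §5.1 (p0022 L42–56): "`L^Σ_p(f) = L_p(f) × ∏_{w∈Σ} P_w(ε⁻¹Ψ⁻¹(Frob_w))`" and the Remark (inert `w`:
  `Ψ(Frob_w) = 1`, factor `(1 − a_ℓ ℓ⁻¹ + ℓ⁻¹)(1 + a_ℓ ℓ⁻¹ + ℓ⁻¹)`).
* Proof of Thm. 6.1.6 (p0026 L82–96): "Let `Σ₁ ⊂ Σ₂` be two finite sets of places of `𝒦` [not]
  dividing `p` and with `Σ₂` containing all the places dividing `N D_𝒦`. Then the surjectivity of
  (restrict-eq1) yields `χ_Λ(X^{Σ₂}_ac(M)) = χ_Λ(X^{Σ₁}_ac(M)) · χ_Λ(∏_{w∈Σ₂∖Σ₁} Hom_𝒪(H¹(𝒦_w, M)/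
  H¹_{𝔉_ac}(𝒦_w, M), L/𝒪)) = χ_Λ(X^{Σ₁}_ac(M)) ∏_{w∈Σ₂∖Σ₁} (P_w(ε⁻¹Ψ⁻¹(Frob_w)))`. Comparing this with
  the definition of `L^{Σ₂}_p(f)` we then see that the hypothesis that `Σ` contain the places
  dividing `N D_𝒦` can be removed".

## Transcription

`X^Σ_ac(M)` = the tree's `AcSelmer.XAc (W.baseChange K) p κ v Σ γ` (Castella 2018 Def. 2.2,
`K_∞`-formulation; JSW's `𝔉_ac` = "`0`" at non-split `w ∤ p` and at `v`, "`H¹_ur`" at split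
`w ∤ p` — equal to the strict condition there for `M = T ⊗ Λ^*`, flag `JSW-331-Kinf-formulation` as in
the tree's Thm. 3.3.1 facts; Shapiro's identification = F1, `SkinnerUrban2014.prop323_…`);
`P_w(ε⁻¹Ψ⁻¹(Frob_w))` = `IwasawaCharacter.eulerFactor p ℤ_[p] Nw t c` (up to a unit of `Λ`, which the
IDEAL statement does not see) for the local data `(Nw, t, c)` of `E/K` at `w` (`IsEulerDataAt`);
`∏_{w∈Σ₂∖Σ₁}` = `sigmaEulerFactor p ℤ_[p] (Σ₂ \ Σ₁) …`. Stated for every `Σ₁ ⊆ Σ₂` (finite, away from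
`p`): the printed display has `Σ₂ ⊇ {w ∣ N D_𝒦}`, and the general case follows by comparing both with
`Σ₂ ∪ {w ∣ N D_𝒦}` in the domain `Λ` (the authors' own "the hypothesis … can be removed").

## Correction (2026-08-27; D-audit `pub/bsd-cited` r04 S3, accepted by the typer of record)

The fact `prop332_charIdeal_XAc_sigma_change` below is **FALSE AS TYPED** on the sub-locus
`B = {w ∈ Σ₂ ∖ Σ₁ totally split in K_∞ (c_w = κ(φ_w) = 0, i.e. w over a prime inert or ramified in K)
with p ∣ #E(K_w)[p^∞]·|P_w(Nw⁻¹)|_p}` — there `Ψ(Frob_w) = 1`, the local term of the `Σ`-change is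
`H¹(K_w, M)^∨ ≅ H¹(K_w, E[p^∞])^∨ ⊗ Λ`, of characteristic ideal `(#H¹(K_w, E[p^∞])) = (#E(K_w)[p^∞])`,
which is `(P_w(Nw⁻¹)) · (c_w(E/K_w))_p` and NOT `(P_w(Nw⁻¹))` when `E/K_w` is split multiplicative with
`p ∣ c_w = ord_w(Δ)` or `p = 3` with additive reduction and `3 ∣ c_w` ([Castella2018] Thm. 2.3 (2.7):
"`∏_{w∈Σ} #H¹(K_w, E[p^∞])`"; Prop. 2.5 and its proof: "`ℋ_w^ur ≃ (ℤ_p/p^{t_E(w)}) ⊗ Λ^*`, `t_E(w) =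
ord_p(c_w(E/K))`" at non-split `w`, "`ℋ_v^ur` vanishes" at split `v ∤ p`; `μ(X_Gr^Σ) = μ(X_ac^Σ) +
Σ_{w nonsplit} ord_p c_w(E/K)`). Print is not affected ([JetchevSkinnerWan2017] uses the display of the
proof of Thm. 6.1.6 inside `Λ_R[1/p]` with `μ = 0`; its Thm. 3.3.1 constant `C^Σ(W)` counts the full
`#H¹(K_w, W)`), but the tree's exact transcription over the wider binders is. At places FINITELY
DECOMPOSED in `K_∞` (`c_w ≠ 0`; every `w ∤ p` over a prime split in `K`, Brink 2007 Thm. 2 = the tree's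
PROVED `ZpExtension.decomp_not_le_kerSubgroup_of_isAnticyclotomic_holds`) the unramified classes are
pseudo-null and the local term IS `(P_w(Nw⁻¹γ_w))` ([GreenbergVatsal2000] Prop. 2.4); at totally split
`w` with `E/K_w` good, non-split multiplicative, or additive with `p ≠ 3`, `#E(K_w)[p^∞] = |P_w(Nw⁻¹)|_p⁻¹`
(`p ∤ c_w`, `Ẽ_ns(k_w)` an `ℓ`-group in the additive case). Per the MIS-STATED protocol the old `def` is
KEPT VERBATIM (it is referenced; do not discharge it, do not bind it in new statements) and the
CORRECTED statement is the NEW fact `prop332_charIdeal_XAc_sigma_change_of_noTamagawaDefect`: the same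
binders plus `∀ w ∈ Σ₂ ∖ Σ₁, NoTamagawaDefect p (t w) (c w)` (`c_w = 0 → t_w ≠ split-multiplicative ∧
(p = 3 → t_w ≠ additive)`), with the corollaries re-threaded (`…'`). The Road-FF data lie outside `B`
(`IsErratumField`: every `ℓ ∣ N`, `ℓ ≠ q` splits in `K`; `w_q` is ramified with `E/K_{w_q}` NON-split
multiplicative; `p ≥ 5`) — see `SigmaEulerData` §7 for the discharge lemmas.

References: [JetchevSkinnerWan2017] §3.3 Prop. 3.3.2, Thm. 3.3.1, §5.1, proof of Thm. 6.1.6;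
[Skinner2016PacificMC] §2.3 p. 180 (cyclotomic analogue, `Ch^{Σ₂} ⊇ Ch^{Σ₁}·∏ P_ℓ`);
[GreenbergVatsal2000] Prop. 2.4; [Castella2018] Def. 2.2, Thm. 2.3 (2.7) (`∏_{w∈Σ} #H¹(K_w, E[p^∞])`),
Prop. 2.5 (`ℋ_w^ur ≃ ℤ_p/p^{t_E(w)} ⊗ Λ^*`); [Brink2007] Thm. 2.
-/

noncomputable section

open scoped Classical
open WeierstrassCurve NumberField IsDedekindDomain Field Literature.NumberTheory.EllipticCurves
  Literature.NumberTheory.EllipticCurves.Rank1Residual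
  Literature.NumberTheory.EllipticCurves.Castella2018
  Literature.NumberTheory.EllipticCurves.IwasawaCharacter
  Literature.NumberTheory.EllipticCurves.BigGaloisRep
  Literature.NumberTheory.GaloisRepresentations

namespace Literature.NumberTheory.EllipticCurves.JetchevSkinnerWan2017

/-! ### Binding the algebraic Euler data to the curve -/

/-- **`(Nw, t, c)` is the Euler datum of `W/K` at the finite place `w ∤ p` for the `ℤ_p`-extension
`κ`**: `Nw = #k_w` (absolute norm), `t` is the reduction type of `W` at `w` (with `a_w` the trace of
Frobenius `q_w + 1 − #Ẽ_w(k_w)` at a good `w`; split / non-split multiplicative OVER `K_w`; additive),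
and `c = κ(φ_w)` for an arithmetic Frobenius `φ_w ∈ Γ_{K_w}` (tree's `IsFrobPow φ_w 1`) pushed into
`Γ_K` along the decomposition map `localMap K (Sum.inl w)` (choice-free: `κ` kills inertia).
[cite: JetchevSkinnerWan2017, §5.1 (the Euler factors `P_w(ε⁻¹Ψ⁻¹(Frob_w))`) and §1 footnote (Euler factors via Frobenius on inertia (co)invariants)]
[cite: Skinner2016PacificMC, §2.3 (p. 180)] -/
def IsEulerDataAt {K : Type} [Field K] [NumberField K] (W : WeierstrassCurve K) {p : ℕ} [Fact p.Prime]
    (κ : ZpExtension K p) (w : HeightOneSpectrum (𝓞 K)) (Nw : ℕ) (t : LocalReductionData)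
    (c : ℤ_[p]) : Prop :=
  Nw = Ideal.absNorm w.asIdeal ∧
  (∃ φ : absoluteGaloisGroup (w.adicCompletion K),
      IsFrobPow φ 1 ∧ κ (localMap K (Sum.inl w) φ) = Multiplicative.ofAdd c) ∧
  (match t with
    | .good a => W.HasGoodReductionAt w ∧ a = W.frobeniusTraceAt w
    | .splitMult => W.HasSplitMultiplicativeReductionAt w
    | .nonsplitMult => W.HasMultiplicativeReductionAt w ∧ ¬ W.HasSplitMultiplicativeReductionAt w
    | .additive => W.HasAdditiveReductionAt w)

/-! ### The named fact -/

/-- ⚠ **FALSE AS TYPED on the locus `B` of the module docstring's "Correction" (totally split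
`w ∈ Σ₂ ∖ Σ₁` with `p ∣ c_w(E/K_w)`: the local term carries the extra factor `(c_w)_p`,
[Castella2018] (2.7), Prop. 2.5); SUPERSEDED by `prop332_charIdeal_XAc_sigma_change_of_noTamagawaDefect`
below; kept verbatim because it is referenced (MIS-STATED protocol) — do not bind it in new statements.**
ORIGINAL TEXT: **Jetchev–Skinner–Wan 2017, Prop. 3.3.2 with the `Σ`-change identity of the proof of Thm. 6.1.6
and the torsion clause of Thm. 3.3.1, for `E/ℚ` over an imaginary quadratic `K`:** under the
hypotheses of the tree's `thm331_anticyclotomicControl_general/_mult` (`p ≥ 3` of good or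
multiplicative reduction, `K` imaginary quadratic with `p = v v̄` split, `E[p]|_{G_K}` irreducible,
`v` the strict prime cut out by `ι`, `κ` anticyclotomic with generator `γ`, `rank E(K) = 1`,
`Ш(E/K)[p^∞]` finite), for all finite sets `Σ₁ ⊆ Σ₂` of places of `K` not above `p` with Euler data
`(Nw, t, c)` on `Σ₂`: `X^{Σ₂}_ac` is `Λ`-torsion and
`Ch_Λ(X^{Σ₂}_ac) = Ch_Λ(X^{Σ₁}_ac) · (∏_{w∈Σ₂∖Σ₁} P_w)` ("the surjectivity of (restrict-eq1) yields
`χ_Λ(X^{Σ₂}_ac(M)) = χ_Λ(X^{Σ₁}_ac(M)) ∏_{w∈Σ₂∖Σ₁} (P_w(ε⁻¹Ψ⁻¹(Frob_w)))`").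
[cite: JetchevSkinnerWan2017, Prop. 3.3.2 (arXiv:1512.06894 Prop. 9, p. 11) with the proof of Thm. 6.1.6 (arXiv Thm. 36, tex p0026 L82–96) and Thm. 3.3.1 (torsion of `X^Σ_ac(M)` for every `Σ ⊂ S_p`), §3.5 (the hypotheses for `A_f = E`)]
[cite: Skinner2016PacificMC, §2.3 (p. 180, "`Ch^{Σ₂}_L(f) ⊇ Ch^{Σ₁}_L(f) · ∏_{ℓ∈Σ₂∖Σ₁}(P_ℓ(Ψ⁻¹ε⁻¹(frob_ℓ)))`", the Euler-factor convention)] -/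
def prop332_charIdeal_XAc_sigma_change : Prop :=
  ∀ (W : WeierstrassCurve ℚ) [W.IsElliptic] [W.IsGloballyMinimal] (p : ℕ) [Fact p.Prime],
    3 ≤ p → (Good W p ∨ Mult W p) →
    ∀ (K : Type) [Field K] [NumberField K], IsImaginaryQuadratic K →
      SatisfiesHeegnerHypothesis p K →
      (W.baseChange K).HasIrreducibleModPGaloisRep p →
    ∀ (ι : K →+* ℚ_[p]) (v : HeightOneSpectrum (𝓞 K)),
      (∀ x : 𝓞 K, x ∈ v.asIdeal ↔ ‖ι (x : K)‖ < 1) →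
    ∀ (κ : ZpExtension K p), κ.IsAnticyclotomic →
    ∀ (γ : absoluteGaloisGroup K) [Fact (κ.IsTopGenerator γ)],
      (W.baseChange K).mordellWeilRank = 1 →
      Finite (AddCommGroup.primaryComponent (W.baseChange K).sha p) →
    ∀ (S₁ S₂ : Finset (HeightOneSpectrum (𝓞 K))), S₁ ⊆ S₂ →
      (∀ w ∈ S₂, ((p : ℕ) : 𝓞 K) ∉ w.asIdeal) →
    ∀ (Nw : HeightOneSpectrum (𝓞 K) → ℕ) (t : HeightOneSpectrum (𝓞 K) → LocalReductionData)
      (c : HeightOneSpectrum (𝓞 K) → ℤ_[p]),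
      (∀ w ∈ S₂, IsEulerDataAt (W.baseChange K) κ w (Nw w) (t w) (c w)) →
      Module.IsTorsion (IwasawaAlgebra p) (AcSelmer.XAc (W.baseChange K) p κ v (↑S₂) γ) ∧
      AcSelmer.XAc.charIdeal (W.baseChange K) p κ v (↑S₂) γ =
        AcSelmer.XAc.charIdeal (W.baseChange K) p κ v (↑S₁) γ *
          Ideal.span {sigmaEulerFactor p ℤ_[p] (S₂ \ S₁) Nw t c}

/-! ### The corrected statement (2026-08-27): no Tamagawa defect at the totally split places -/

/-- **No Tamagawa defect at a place `w ∤ p` with Euler datum `(t, c)`**: if `w` is totally split in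
`K_∞` (`c = κ(φ_w) = 0`, so `Ψ(Frob_w) = 1` and the `Σ`-local term at `w` is `H¹(K_w, E[p^∞])^∨ ⊗ Λ`, of
characteristic ideal `(#E(K_w)[p^∞])`), then `E/K_w` is NOT split multiplicative and, when `p = 3`, NOT
additive — exactly the reduction types for which `p ∤ c_w(E/K_w)` and `#E(K_w)[p^∞] = |P_w(Nw⁻¹)|_p⁻¹`
unconditionally (good: `c_w = 1`; non-split multiplicative: `c_w ∈ {1, 2}`, `#E(K_w)[p^∞] = (Nw + 1)_p`;
additive, `p ≥ 5`: `c_w ≤ 4` and `Ẽ_ns(k_w) = 𝔾_a`), so that the local term is `(P_w(Nw⁻¹))` as in the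
displayed identity. Vacuous at finitely decomposed places (`c ≠ 0`).
[cite: Castella2018, Thm. 2.3 (2.7) and Prop. 2.5 with its proof (arXiv:1704.06608 pp. 5, 7: "`ℋ_w^ur ≃ (ℤ_p/p^{t_E(w)}ℤ_p) ⊗ Λ^*`, `t_E(w) = ord_p(c_w(E/K))`")] -/
def NoTamagawaDefect (p : ℕ) [Fact p.Prime] (t : LocalReductionData) (c : ℤ_[p]) : Prop :=
  c = 0 → t ≠ .splitMult ∧ (p = 3 → t ≠ .additive)

/-- A finitely decomposed place (`c ≠ 0`) carries no Tamagawa defect. [cite: Castella2018, Prop. 2.5 (proof: "`ℋ_v^ur` vanishes" at the split `v ∤ p`)] -/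
theorem noTamagawaDefect_of_ne_zero {p : ℕ} [Fact p.Prime] {t : LocalReductionData} {c : ℤ_[p]} (hc : c ≠ 0) :
    NoTamagawaDefect p t c :=
  fun h => absurd h hc

/-- A place of good reduction carries no Tamagawa defect (`c_w = 1`). [cite: Castella2018, Thm. 2.3 (2.7) (`c_w` only at `w ∣ N`)] -/
theorem noTamagawaDefect_good {p : ℕ} [Fact p.Prime] (a : ℤ) (c : ℤ_[p]) : NoTamagawaDefect p (.good a) c :=
  fun _ => ⟨by simp, fun _ => by simp⟩

/-- A place of non-split multiplicative reduction carries no Tamagawa defect (`c_w ∈ {1, 2}`, `p` odd in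
all uses). [cite: Castella2018, Prop. 2.5 (`t_E(w) = ord_p c_w(E/K)`)] -/
theorem noTamagawaDefect_nonsplitMult {p : ℕ} [Fact p.Prime] (c : ℤ_[p]) : NoTamagawaDefect p .nonsplitMult c :=
  fun _ => ⟨by simp, fun _ => by simp⟩

/-- A place of additive reduction carries no Tamagawa defect when `p ≠ 3` (`c_w ≤ 4`).
[cite: Castella2018, Prop. 2.5 (`t_E(w) = ord_p c_w(E/K)`)] -/
theorem noTamagawaDefect_additive {p : ℕ} [Fact p.Prime] (hp : p ≠ 3) (c : ℤ_[p]) : NoTamagawaDefect p .additive c :=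
  fun _ => ⟨by simp, fun h => absurd h hp⟩

/-- If the reduction is split multiplicative only at finitely decomposed places and `p ≠ 3`, there is no
Tamagawa defect. [cite: Castella2018, Prop. 2.5 and its proof] -/
theorem noTamagawaDefect_of_splitMult_imp {p : ℕ} [Fact p.Prime] (hp : p ≠ 3) {t : LocalReductionData} {c : ℤ_[p]}
    (h : t = .splitMult → c ≠ 0) : NoTamagawaDefect p t c :=
  fun hc => ⟨fun ht => h ht hc, fun h3 => absurd h3 hp⟩

/-- **CORRECTED FACT (supersedes `prop332_charIdeal_XAc_sigma_change`). Jetchev–Skinner–Wan 2017,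
Prop. 3.3.2 with the `Σ`-change identity of the proof of Thm. 6.1.6 and the torsion clause of Thm. 3.3.1,
for `E/ℚ` over an imaginary quadratic `K`, AWAY FROM THE TAMAGAWA DEFECT:** under the hypotheses of the
tree's `thm331_anticyclotomicControl_general/_mult` (`p ≥ 3` of good or multiplicative reduction, `K`
imaginary quadratic with `p = v v̄` split, `E[p]|_{G_K}` irreducible, `v` the strict prime cut out by `ι`,
`κ` anticyclotomic with generator `γ`, `rank E(K) = 1`, `Ш(E/K)[p^∞]` finite), for all finite sets
`Σ₁ ⊆ Σ₂` of places of `K` not above `p` with Euler data `(Nw, t, c)` on `Σ₂` such that NO `w ∈ Σ₂ ∖ Σ₁`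
CARRIES A TAMAGAWA DEFECT (`NoTamagawaDefect p (t w) (c w)`: at the places totally split in `K_∞` the
reduction is not split multiplicative, and not additive if `p = 3`): `X^{Σ₂}_ac` is `Λ`-torsion and
`Ch_Λ(X^{Σ₂}_ac) = Ch_Λ(X^{Σ₁}_ac) · (∏_{w∈Σ₂∖Σ₁} P_w)` ("the surjectivity of (restrict-eq1) yields
`χ_Λ(X^{Σ₂}_ac(M)) = χ_Λ(X^{Σ₁}_ac(M)) · χ_Λ(∏_{w∈Σ₂∖Σ₁} Hom_𝒪(H¹(𝒦_w, M)/H¹_{𝔉_ac}(𝒦_w, M), L/𝒪))`",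
the local factor being `(P_w(ε⁻¹Ψ⁻¹(Frob_w)))` at the finitely decomposed `w` [GreenbergVatsal2000,
Prop. 2.4] and `(#H¹(K_w, E[p^∞])) = (#E(K_w)[p^∞]) = (P_w(Nw⁻¹))` at the totally split `w` without
Tamagawa defect [Castella2018, (2.7), Prop. 2.5]). A conjunction of published results, each cited; the
binder `NoTamagawaDefect` is exactly what separates it from the false wider transcription above.
[cite: JetchevSkinnerWan2017, Prop. 3.3.2 (arXiv:1512.06894 Prop. 9, p. 11) with the proof of Thm. 6.1.6 (arXiv Thm. 36, tex p0026 L82–96) and Thm. 3.3.1 (torsion of `X^Σ_ac(M)`, `Σ ⊂ S_p`), §3.5]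
[cite: Castella2018, Thm. 2.3 (2.7) and Prop. 2.5 with its proof (arXiv:1704.06608 pp. 5, 7)]
[cite: GreenbergVatsal2000, Prop. 2.4] [cite: Skinner2016PacificMC, §2.3 (p. 180, the Euler-factor convention)] -/
def prop332_charIdeal_XAc_sigma_change_of_noTamagawaDefect : Prop :=
  ∀ (W : WeierstrassCurve ℚ) [W.IsElliptic] [W.IsGloballyMinimal] (p : ℕ) [Fact p.Prime],
    3 ≤ p → (Good W p ∨ Mult W p) →
    ∀ (K : Type) [Field K] [NumberField K], IsImaginaryQuadratic K →
      SatisfiesHeegnerHypothesis p K →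
      (W.baseChange K).HasIrreducibleModPGaloisRep p →
    ∀ (ι : K →+* ℚ_[p]) (v : HeightOneSpectrum (𝓞 K)),
      (∀ x : 𝓞 K, x ∈ v.asIdeal ↔ ‖ι (x : K)‖ < 1) →
    ∀ (κ : ZpExtension K p), κ.IsAnticyclotomic →
    ∀ (γ : absoluteGaloisGroup K) [Fact (κ.IsTopGenerator γ)],
      (W.baseChange K).mordellWeilRank = 1 →
      Finite (AddCommGroup.primaryComponent (W.baseChange K).sha p) →
    ∀ (S₁ S₂ : Finset (HeightOneSpectrum (𝓞 K))), S₁ ⊆ S₂ →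
      (∀ w ∈ S₂, ((p : ℕ) : 𝓞 K) ∉ w.asIdeal) →
    ∀ (Nw : HeightOneSpectrum (𝓞 K) → ℕ) (t : HeightOneSpectrum (𝓞 K) → LocalReductionData)
      (c : HeightOneSpectrum (𝓞 K) → ℤ_[p]),
      (∀ w ∈ S₂, IsEulerDataAt (W.baseChange K) κ w (Nw w) (t w) (c w)) →
      (∀ w ∈ S₂ \ S₁, NoTamagawaDefect p (t w) (c w)) →
      Module.IsTorsion (IwasawaAlgebra p) (AcSelmer.XAc (W.baseChange K) p κ v (↑S₂) γ) ∧
      AcSelmer.XAc.charIdeal (W.baseChange K) p κ v (↑S₂) γ =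
        AcSelmer.XAc.charIdeal (W.baseChange K) p κ v (↑S₁) γ *
          Ideal.span {sigmaEulerFactor p ℤ_[p] (S₂ \ S₁) Nw t c}

/-! ### Proved corollaries in the glue's shape -/

section Corollaries

variable (W : WeierstrassCurve ℚ) [W.IsElliptic] [W.IsGloballyMinimal] (p : ℕ) [Fact p.Prime]
  (hp : 3 ≤ p) (hred : Good W p ∨ Mult W p)
  (K : Type) [Field K] [NumberField K] (hK : IsImaginaryQuadratic K)
  (hsplit : SatisfiesHeegnerHypothesis p K) (hirr : (W.baseChange K).HasIrreducibleModPGaloisRep p)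
  (ι : K →+* ℚ_[p]) (v : HeightOneSpectrum (𝓞 K)) (hv : ∀ x : 𝓞 K, x ∈ v.asIdeal ↔ ‖ι (x : K)‖ < 1)
  (κ : ZpExtension K p) (hκ : κ.IsAnticyclotomic)
  (γ : absoluteGaloisGroup K) [Fact (κ.IsTopGenerator γ)]
  (hrk : (W.baseChange K).mordellWeilRank = 1)
  (hsha : Finite (AddCommGroup.primaryComponent (W.baseChange K).sha p))
  (S : Finset (HeightOneSpectrum (𝓞 K))) (hSp : ∀ w ∈ S, ((p : ℕ) : 𝓞 K) ∉ w.asIdeal)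
  (Nw : HeightOneSpectrum (𝓞 K) → ℕ) (t : HeightOneSpectrum (𝓞 K) → LocalReductionData)
  (c : HeightOneSpectrum (𝓞 K) → ℤ_[p])
  (hdata : ∀ w ∈ S, IsEulerDataAt (W.baseChange K) κ w (Nw w) (t w) (c w))

include hp hred hK hsplit hirr hv hκ hrk hsha hSp hdata

/-- **`Ch_Λ(X^Σ_ac) = Ch_Λ(X^∅_ac) · (P_Σ)`** (the case `Σ₁ = ∅`).
[cite: JetchevSkinnerWan2017, Prop. 3.3.2 with the proof of Thm. 6.1.6] -/
theorem charIdeal_XAc_eq_charIdeal_empty_mul (h : prop332_charIdeal_XAc_sigma_change) :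
    AcSelmer.XAc.charIdeal (W.baseChange K) p κ v (↑S) γ =
      AcSelmer.XAc.charIdeal (W.baseChange K) p κ v ∅ γ *
        Ideal.span {sigmaEulerFactor p ℤ_[p] S Nw t c} := by
  have h2 := (h W p hp hred K hK hsplit hirr ι v hv κ hκ γ hrk hsha ∅ S (Finset.empty_subset S) hSp
    Nw t c hdata).2
  simpa only [Finset.coe_empty, Finset.sdiff_empty] using h2

/-- **The glue's `hSig`**: `Ch_Λ(X^∅_ac) · (P_Σ) ≤ Ch_Λ(X^Σ_ac)` (with equality).
[cite: JetchevSkinnerWan2017, Prop. 3.3.2 with the proof of Thm. 6.1.6] -/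
theorem charIdeal_XAc_empty_mul_le (h : prop332_charIdeal_XAc_sigma_change) :
    AcSelmer.XAc.charIdeal (W.baseChange K) p κ v ∅ γ *
        Ideal.span {sigmaEulerFactor p ℤ_[p] S Nw t c} ≤
      AcSelmer.XAc.charIdeal (W.baseChange K) p κ v (↑S) γ :=
  (charIdeal_XAc_eq_charIdeal_empty_mul W p hp hred K hK hsplit hirr ι v hv κ hκ γ hrk hsha S hSp Nw t c
    hdata h).ge

/-- **`X^Σ_ac` is `Λ`-torsion** for every finite `Σ` away from `p` (the torsion clause; feeds the
glue's `hT` through F1). [cite: JetchevSkinnerWan2017, Thm. 3.3.1 (torsion of `X^Σ_ac(M)`, `Σ ⊂ S_p`)] -/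
theorem isTorsion_XAc_sigma (h : prop332_charIdeal_XAc_sigma_change) :
    Module.IsTorsion (IwasawaAlgebra p) (AcSelmer.XAc (W.baseChange K) p κ v (↑S) γ) :=
  (h W p hp hred K hK hsplit hirr ι v hv κ hκ γ hrk hsha S S le_rfl hSp Nw t c hdata).1

/-! #### The same corollaries from the CORRECTED fact -/

/-- **`Ch_Λ(X^Σ_ac) = Ch_Λ(X^∅_ac) · (P_Σ)`** (the case `Σ₁ = ∅`), from the corrected fact, for `Σ`
without Tamagawa defect. [cite: JetchevSkinnerWan2017, Prop. 3.3.2 with the proof of Thm. 6.1.6] [cite: Castella2018, (2.7), Prop. 2.5] -/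
theorem charIdeal_XAc_eq_charIdeal_empty_mul' (h : prop332_charIdeal_XAc_sigma_change_of_noTamagawaDefect)
    (hB : ∀ w ∈ S, NoTamagawaDefect p (t w) (c w)) :
    AcSelmer.XAc.charIdeal (W.baseChange K) p κ v (↑S) γ =
      AcSelmer.XAc.charIdeal (W.baseChange K) p κ v ∅ γ *
        Ideal.span {sigmaEulerFactor p ℤ_[p] S Nw t c} := by
  have h2 := (h W p hp hred K hK hsplit hirr ι v hv κ hκ γ hrk hsha ∅ S (Finset.empty_subset S) hSp
    Nw t c hdata (by simpa only [Finset.sdiff_empty] using hB)).2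
  simpa only [Finset.coe_empty, Finset.sdiff_empty] using h2

/-- **The glue's `hSig`** from the corrected fact: `Ch_Λ(X^∅_ac) · (P_Σ) ≤ Ch_Λ(X^Σ_ac)` for `Σ` without
Tamagawa defect. [cite: JetchevSkinnerWan2017, Prop. 3.3.2 with the proof of Thm. 6.1.6] [cite: Castella2018, (2.7), Prop. 2.5] -/
theorem charIdeal_XAc_empty_mul_le' (h : prop332_charIdeal_XAc_sigma_change_of_noTamagawaDefect)
    (hB : ∀ w ∈ S, NoTamagawaDefect p (t w) (c w)) :
    AcSelmer.XAc.charIdeal (W.baseChange K) p κ v ∅ γ *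
        Ideal.span {sigmaEulerFactor p ℤ_[p] S Nw t c} ≤
      AcSelmer.XAc.charIdeal (W.baseChange K) p κ v (↑S) γ :=
  (charIdeal_XAc_eq_charIdeal_empty_mul' W p hp hred K hK hsplit hirr ι v hv κ hκ γ hrk hsha S hSp Nw t c
    hdata h hB).ge

/-- **`X^Σ_ac` is `Λ`-torsion** for every finite `Σ` away from `p`, from the corrected fact (the
defect binder is vacuous for `Σ₁ = Σ₂`). [cite: JetchevSkinnerWan2017, Thm. 3.3.1 (torsion of `X^Σ_ac(M)`, `Σ ⊂ S_p`)] -/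
theorem isTorsion_XAc_sigma' (h : prop332_charIdeal_XAc_sigma_change_of_noTamagawaDefect) :
    Module.IsTorsion (IwasawaAlgebra p) (AcSelmer.XAc (W.baseChange K) p κ v (↑S) γ) :=
  (h W p hp hred K hK hsplit hirr ι v hv κ hκ γ hrk hsha S S le_rfl hSp Nw t c hdata
    (fun w hw => absurd hw (by simp))).1

end Corollaries

end Literature.NumberTheory.EllipticCurves.JetchevSkinnerWan2017

end
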